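import Summits.QuantumFields.BalabanUV.T4Continuum.Support.NE7PairDecompNL0
import Summits.QuantumFields.BalabanUV.T4Continuum.Support.NE7EnergySliceSpikeResidual
import Summits.QuantumFields.BalabanUV.T4Continuum.Support.NE7HintUnconditionalSU2
import Summits.QuantumFields.BalabanUV.T4Continuum.Support.NE7ConvOneStepWeighted
import Summits.QuantumFields.BalabanUV.T4Continuum.Support.NE7EnergyBlockLandauClassPoincare
import Summits.QuantumFields.BalabanUV.T4Continuum.Support.NE7RepWGaugeOfRoutePi
import Summits.QuantumFields.BalabanUV.T4Continuum.Support.NE7EtaMinimiserGaugeCovariance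
import Summits.QuantumFields.BalabanUV.T4Continuum.Support.NE3EnergyWeightedSupShape
import Summits.QuantumFields.BalabanUV.T4Continuum.Support.NE3EnergyChartLeaves
import HarnessLib

/-!
# NE7EnergyRateWPrep — BOOKKEEPING FOR NODE NE3's RE-TYPED ROOT T-E_w♯ AT SU(2), d = 4, L = 2 (assembly: `NE7EnergyRateWSU2.ne3EnergyRateWSup_SU2`): positivity of the deficit-wall constants,
# the lower bound `wallConst·dualC2·√g·N²∕(2M) ≤ residualScale`, the admissibility of the block average `cavg 2 U_B` of a regular finer minimiser as a competitor of the coarser problem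
# (`prop1Radius`, line `b + 10⁸b² ≤ ε`), the k-free minorant of the convexity coefficient, and the pure real bookkeeping of the two-sided energy inequality

Cell `pub-balaban`, rung (B)+1 sub-cell t4, lineage `b2b-balaban-t4-ne7-p1`, generation 105 (CRUX PROVER NE7 #1 = OWNER of BINDER row NE7).  Memo `t4/b2b-balaban-t4-ne7-p1-g105/ROAD-G105.md` §3.
WHAT ([folklore]; 0 def, 0 sorry).  §1 `le_add_sqrt_of_sq_le` (`x² ≤ ax + b ⟹ x ≤ a + √b`), `wallConst_pos`, `dualC2_pos_d4`, **`residualScale_lower_d4`**; §2 **`cavg_admissible_d4`** (`0 < ε ≤ 10⁻¹¹`,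
`0 ≤ b`, `b + 10⁸b² ≤ ε`: `cavg 2 U_B` is unitary, `(N·2^{j+1})`-periodic, `SmallField (ε∕4^{j+1})`, admissible at level `j+1` over the same datum, with the class family lines
`NE7ConvOneStepSU2.levelSmall_all_d4_L2`; inputs `AveragingDeficitTwoLevelPrep.smallField_cavg`, `AveragingDeficitFermat.isPeriodicCfg_cavg`, `NE3EnergyChartLeaves.isUnitaryCfg_cavg_of_regular`,
`MinimalActionLevels.avgIter_rescale_bavg`); §3 **`kfree_coercivity`** (the coefficient of `NE7ConvOneStepWeighted.hess_vary_ge_weighted` at the per-pair letters dominates its k-free minorant at the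
ceilings — `NE7RepWGaugeOfRoutePi.exp_term_le_of_currency`); §3b `spike_coef_le`, `spike_energy_le`, `two_sided_ineq`, `rate_algebra`, `ratio_le_of_lower` (pure real arithmetic).
HONEST FRAMING (page 1): bookkeeping over landed kernel theorems; nothing of Bałaban's asserted; NOT T-E_w♯ (next file), NOT NE3, NOT NE7; spine count unchanged; finite T⁴ rung (B)+1 — NOT infinite
volume, NOT mass gap, NOT BetaPertH, NOT Clay (continuum YM on T⁴ ⇐ BetaPertH ∧ nine spine estimates).
-/

set_option autoImplicit false

open scoped BigOperators Matrix Matrix.Norms.L2Operator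
open NormedSpace Finset Set

namespace Summit.QuantumFields.BalabanUV.T4Continuum.NE7EnergyRateWPrep

open Literature.MathematicalPhysics.QuantumFieldTheory.Balaban1983to89
open B7Prop1Explicit B7Prop2Explicit
open T4AveragingDeficitWall (IsUnitaryCfg IsSkewDir SmallField fineAction vary curl curlSq dirSq)
open T4AveragingDeficitWallBoundary (IsPeriodicCfg periodBox)
open T4ConvexResponse (taylor_lower)
open AveragingDeficitPeriodicCounting (IsPeriodicDir)
open AveragingDeficitDerivWallProof (wallConst wallConst_nonneg)
open AveragingDeficitCoreAxial (coreC_nonneg)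
open AveragingDeficitDualResidual (dualC2 dualC1)
open AveragingDeficitChartCalculus (cavg)
open AveragingDeficitTwoLevelPrep (prop1Radius smallField_cavg)
open AveragingDeficitFermat (isPeriodicCfg_cavg)
open AveragingDeficitMultiLevelPrep (LevelSmall tower)
open AveragingDeficitMultiLevelBridge (cavg_eq_rescale_bavg)
open MinimalActionLevels (perWin levelAction avgIter_rescale_bavg stepWt_pos)
open MinimalActionSandwich (IsMinimiser admissible)
open MinimalActionRate (sfClass Regular)
open NE3HessForm (dAction hess segment_derivData)
open NE3SlicePoincareBudgetLine (CPLine)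
open NE3ClassRadiusFamily (CPLine_nonneg_d4_L2)
open NE3EnergyShapes (IsUnitarySite IsPeriodicSite residualScale residualScale_nonneg dualC1_nonneg dualC2_nonneg)
open NE3EnergyWeightedShapes (energyNormW energyNormW_nonneg)
open NE3EnergyWeightedSupShape (NE3EnergyRateWSup)
open NE3WeightedCoercivityTransfer (energyNormW_sq)
open NE3ProductPathBounds (energyNormW_sub_le)
open NE3EnergyChartLeaves (isUnitaryCfg_cavg_of_regular)
open NE3RightInverseSupLetters (frameC)
open NE3AxialGaugeLadder (smallField_gaugeAct)
open NE7MeanZeroGaugeSliceW (energyBlockLandauW)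
open NE7EnergyBlockLandauClassPoincare (classSlicePoincare_energyBlockLandau_SU2)
open NE7ConvOneStepSU2 (levelSmall_all_d4_L2)
open NE7ConvOneStepWeighted (curlSq_ge_weighted hess_vary_ge_weighted)
open NE7SegmentPlaquetteRadius (smallField_vary_segment_class)
open NE7OneStepLetters (abs_dAction_le_radius_mul)
open NE7ExactCurrent (dAction_add)
open NE7EtaMinimiserGaugeCovariance (levelAction_gaugeAct)
open NE7RepWGaugeOfRoutePi (exp_term_le_of_currency)
open NE7HintUnconditionalSU2 (line_of_small)
open NE7PairDecompNL0 (decomp_of_nl0_pair)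
open NE7EnergySliceSpikeResidual (energyNormW_spike_sq_le spike_tangent_data abs_dAction_le_of_regular_slice)
open BlockAveragePushDirGauge (gaugeDir)
open NE3CornerSpikes (spikeW)
open NE3TangentCovariantTower (framePotW)

noncomputable section

/-! ## §1 Arithmetic and positivity -/

/-- `x² ≤ a·x + b` with `x, a, b ≥ 0` ⟹ `x ≤ a + √b`. [folklore] -/
theorem le_add_sqrt_of_sq_le {x a b : ℝ} (ha : 0 ≤ a) (hb : 0 ≤ b) (h : x ^ 2 ≤ a * x + b) : x ≤ a + Real.sqrt b := by
  by_contra H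
  rw [not_le] at H
  have hs0 : 0 ≤ Real.sqrt b := Real.sqrt_nonneg b
  have hsb : Real.sqrt b * Real.sqrt b = b := Real.mul_self_sqrt hb
  nlinarith [mul_lt_mul_of_pos_left H (lt_of_le_of_lt (add_nonneg ha hs0) H), hsb, mul_nonneg ha hs0]

/-- The deficit wall constant is positive (its last summand is `4`). [folklore] -/
theorem wallConst_pos (d L : ℕ) : 0 < wallConst d L := by
  unfold wallConst AveragingDeficitDerivAssembly.assemblyConst
  have h1 := (coreC_nonneg d L).1; have h2 := (coreC_nonneg d L).2
  positivity

/-- `dualC2 4 2 > 0` (there is a plane in four dimensions). [folklore] -/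
theorem dualC2_pos_d4 : 0 < dualC2 4 2 := by
  unfold dualC2
  have hP : 0 < Fintype.card (T4AveragingDeficitWall.Plane 4) :=
    Fintype.card_pos_iff.mpr ⟨⟨((0 : Fin 4), (1 : Fin 4)), by decide⟩⟩
  have hP' : (0 : ℝ) < Fintype.card (T4AveragingDeficitWall.Plane 4) := by exact_mod_cast hP
  have hs : 0 < Real.sqrt (8 * Fintype.card (T4AveragingDeficitWall.Plane 4)) := Real.sqrt_pos.2 (by positivity)
  positivity

/-- **THE RESIDUAL SCALE DOMINATES ITS FLUX-GRADIENT TERM** (`d = 4`, `L = 2`, level `j+1`, `M := 2^{j+1}`): `wallConst·dualC2·√g·N²∕(2M) ≤ residualScale 4 2 N b g (j+1)` (`g ≥ 0`). [folklore] -/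
theorem residualScale_lower_d4 (N j : ℕ) {b g : ℝ} (hg : 0 ≤ g) :
    wallConst 4 2 * dualC2 4 2 * Real.sqrt g * (N : ℝ) ^ 2 / (2 * ((2 : ℕ) : ℝ) ^ (j + 1)) ≤ residualScale 4 2 N b g (j + 1) := by
  unfold residualScale
  have hM0 : (0 : ℝ) < ((2 : ℕ) : ℝ) ^ (j + 1 + 1) := by positivity
  have hw := wallConst_nonneg 4 2
  have hd2 := dualC2_nonneg 4 2
  have hd1 := dualC1_nonneg 4 2
  have hz : ((2 : ℕ) : ℝ) ^ (4 - ((4 : ℕ) : ℤ)) = 1 := by norm_num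
  rw [hz, one_mul]
  -- the flux-gradient term: `√(g N⁴ M′⁴/M′⁶) = √g·N²/M′`, `M′ = 2M`
  have hid : g * (N : ℝ) ^ 4 * (((2 : ℕ) : ℝ) ^ (j + 1 + 1)) ^ 4 / (((2 : ℕ) : ℝ) ^ (j + 1 + 1)) ^ 6
      = (Real.sqrt g * (N : ℝ) ^ 2 / ((2 : ℕ) : ℝ) ^ (j + 1 + 1)) ^ 2 := by
    rw [div_pow, mul_pow, Real.sq_sqrt hg]; field_simp
  have hsq : Real.sqrt (g * (N : ℝ) ^ 4 * (((2 : ℕ) : ℝ) ^ (j + 1 + 1)) ^ 4 / (((2 : ℕ) : ℝ) ^ (j + 1 + 1)) ^ 6)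
      = Real.sqrt g * (N : ℝ) ^ 2 / ((2 : ℕ) : ℝ) ^ (j + 1 + 1) := by
    rw [hid, Real.sqrt_sq (by positivity)]
  rw [hsq]
  have hM' : ((2 : ℕ) : ℝ) ^ (j + 1 + 1) = 2 * ((2 : ℕ) : ℝ) ^ (j + 1) := by rw [pow_succ]; push_cast; ring
  rw [hM']
  have h2 : 0 ≤ (b / (2 * ((2 : ℕ) : ℝ) ^ (j + 1)) ^ 2) ^ 2 * dualC1 4 2 * Real.sqrt (4 * ((N * 2 ^ (j + 1) : ℕ) : ℝ) ^ 4) := by positivity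
  have h3 : wallConst 4 2 * dualC2 4 2 * Real.sqrt g * (N : ℝ) ^ 2 / (2 * ((2 : ℕ) : ℝ) ^ (j + 1))
      = wallConst 4 2 * (Real.sqrt g * (N : ℝ) ^ 2 / (2 * ((2 : ℕ) : ℝ) ^ (j + 1)) * dualC2 4 2) := by ring
  rw [h3]
  exact mul_le_mul_of_nonneg_left (le_add_of_nonneg_right h2) hw

/-! ## §2 The block average of a regular finer minimiser is an admissible competitor -/

/-- **`cavg 2 U_B` IS ADMISSIBLE** (`d = 4`, `L = 2`, `0 < ε ≤ 10⁻¹¹`, `0 ≤ b`, `b + 10⁸·b² ≤ ε`): for a level-`(j+2)` minimiser `U_B` of `sfClass 4 2 N ε` with datum `V` and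
`Regular 4 2 N b g (j+2) U_B`, the block average `W := cavg 2 U_B` is unitary, `(N·2^{j+1})`-periodic, `SmallField W (ε∕(2^{j+1})²)` and admissible at level `j+1` over `V`;
with the class family lines `LevelSmall 4 2 j (ε∕(2^{j+1})²)`, `LevelSmall 4 2 (j+1) (ε∕(2^{j+2})²)` and `b < ε`. [folklore] -/
theorem cavg_admissible_d4 {n : Type} [Fintype n] [DecidableEq n] [Nonempty n] {N : ℕ} [NeZero N] (j : ℕ) {ε b g : ℝ}
    (hε : 0 < ε) (hε11 : ε ≤ 1 / 10 ^ 11) (hb : 0 ≤ b) (hbq : b + 10 ^ 8 * b ^ 2 ≤ ε)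
    {V UB : Site 4 → Fin 4 → (Matrix n n ℂ)ˣ} (hB : IsMinimiser 4 (sfClass 4 2 N ε) 2 N (j + 2) V UB) (hreg : Regular 4 2 N b g (j + 2) UB) :
    b < ε ∧ LevelSmall 4 2 j (ε / (((2 : ℕ) : ℝ) ^ (j + 1)) ^ 2) ∧ LevelSmall 4 2 (j + 1) (ε / (((2 : ℕ) : ℝ) ^ (j + 2)) ^ 2) ∧
    IsUnitaryCfg (cavg 2 UB) ∧ IsPeriodicCfg (cavg 2 UB) ((N * 2 ^ (j + 1) : ℕ) : ℤ) ∧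
    SmallField (cavg 2 UB) (ε / (((2 : ℕ) : ℝ) ^ (j + 1)) ^ 2) ∧
    cavg 2 UB ∈ admissible (sfClass 4 2 N ε) 2 (j + 1) V := by
  have hbε : b < ε := by
    rcases hb.eq_or_lt with h0 | hpos
    · rw [← h0]; exact hε
    · nlinarith
  have hs1 : LevelSmall 4 2 j (ε / (((2 : ℕ) : ℝ) ^ (j + 1)) ^ 2) := levelSmall_all_d4_L2 hε.le hε11 j
  have hs2 : LevelSmall 4 2 (j + 1) (ε / (((2 : ℕ) : ℝ) ^ (j + 2)) ^ 2) := levelSmall_all_d4_L2 hε.le hε11 (j + 1)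
  have hWu : IsUnitaryCfg (cavg 2 UB) := isUnitaryCfg_cavg_of_regular (le_refl 1 |>.trans one_le_two) j hb hbε hs2 hreg
  -- periodicity: `U_B` is `(N·2^{j+2}) = 2·(N·2^{j+1})`-periodic
  have hper : IsPeriodicCfg UB ((2 : ℤ) * ((N * 2 ^ (j + 1) : ℕ) : ℤ)) := by
    have e : ((2 : ℤ) * ((N * 2 ^ (j + 1) : ℕ) : ℤ)) = ((N * 2 ^ (j + 2) : ℕ) : ℤ) := by push_cast; ring
    rw [e]; exact hreg.periodic
  have hWP : IsPeriodicCfg (cavg 2 UB) ((N * 2 ^ (j + 1) : ℕ) : ℤ) := isPeriodicCfg_cavg 2 (N * 2 ^ (j + 1)) (by exact_mod_cast hper)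
  -- the small-field radius: `prop1Radius 4 2 (b/(2^{j+2})²) ≤ ε/(2^{j+1})²`
  have hP0 : (0 : ℝ) < (((2 : ℕ) : ℝ) ^ (j + 2)) ^ 2 := by positivity
  have ha : 0 ≤ b / (((2 : ℕ) : ℝ) ^ (j + 2)) ^ 2 := div_nonneg hb hP0.le
  have h512 : 512 * (4 + 1) * (4 + 4) * ((2 : ℕ) : ℝ) ^ 2 * (b / (((2 : ℕ) : ℝ) ^ (j + 2)) ^ 2) ≤ 1 := by
    have hP1 : (1 : ℝ) ≤ (((2 : ℕ) : ℝ) ^ (j + 2)) ^ 2 := one_le_pow₀ (one_le_pow₀ (by norm_num))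
    have hb1 : b ≤ 1 / 10 ^ 11 := by nlinarith
    have : b / (((2 : ℕ) : ℝ) ^ (j + 2)) ^ 2 ≤ b := div_le_self hb hP1
    push_cast; nlinarith
  have hsm := smallField_cavg (d := 4) (le_refl 1 |>.trans one_le_two) hreg.unitary ha (by push_cast at h512 ⊢; exact h512) hreg.small
  have hrad : prop1Radius 4 2 (b / (((2 : ℕ) : ℝ) ^ (j + 2)) ^ 2) ≤ ε / (((2 : ℕ) : ℝ) ^ (j + 1)) ^ 2 := by
    unfold prop1Radius
    have hP1 : (1 : ℝ) ≤ (((2 : ℕ) : ℝ) ^ (j + 2)) ^ 2 := one_le_pow₀ (one_le_pow₀ (by norm_num))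
    have e1 : (((2 : ℕ) : ℝ) ^ (j + 2)) ^ 2 = 4 * (((2 : ℕ) : ℝ) ^ (j + 1)) ^ 2 := by rw [pow_succ]; push_cast; ring
    set P : ℝ := (((2 : ℕ) : ℝ) ^ (j + 2)) ^ 2 with hPdef
    have hQ : (((2 : ℕ) : ℝ) ^ (j + 1)) ^ 2 = P / 4 := by rw [e1]; ring
    rw [hQ]
    have hb2 : (b / P) ^ 2 ≤ b ^ 2 / P := by
      rw [div_pow]
      exact div_le_div_of_nonneg_left (sq_nonneg b) hP0 (by nlinarith)
    -- the honest inequality: `4(b/P) + 226(8·5·8·4·(b/P))² ≤ 4ε/P`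
    have h2 : ((2 : ℕ) : ℝ) ^ 2 * (b / P) + 226 * (8 * (((4 : ℕ) : ℝ) + 1) * (((4 : ℕ) : ℝ) + 4) * ((2 : ℕ) : ℝ) ^ 2 * (b / P)) ^ 2
        ≤ ε / (P / 4) := by
      have e2 : ε / (P / 4) = 4 * ε / P := by field_simp
      rw [e2]
      have e3 : ((2 : ℕ) : ℝ) ^ 2 * (b / P) + 226 * (8 * (((4 : ℕ) : ℝ) + 1) * (((4 : ℕ) : ℝ) + 4) * ((2 : ℕ) : ℝ) ^ 2 * (b / P)) ^ 2
          = 4 * (b / P) + 226 * 1280 ^ 2 * (b / P) ^ 2 := by push_cast; ring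
      rw [e3]
      have h4 : 4 * (b / P) + 226 * 1280 ^ 2 * (b / P) ^ 2 ≤ 4 * (b / P) + 226 * 1280 ^ 2 * (b ^ 2 / P) := by nlinarith
      refine h4.trans ?_
      rw [show 4 * (b / P) + 226 * 1280 ^ 2 * (b ^ 2 / P) = (4 * b + 226 * 1280 ^ 2 * b ^ 2) / P by ring]
      exact div_le_div_of_nonneg_right (by nlinarith) hP0.le
    exact h2
  have hWx : SmallField (cavg 2 UB) (ε / (((2 : ℕ) : ℝ) ^ (j + 1)) ^ 2) := MinimalActionRate.SmallField.mono hsm hrad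
  have hadm : cavg 2 UB ∈ admissible (sfClass 4 2 N ε) 2 (j + 1) V := by
    refine ⟨⟨hWu, hWP, hWx⟩, ?_⟩
    rw [cavg_eq_rescale_bavg, avgIter_rescale_bavg]
    exact hB.mem.2
  exact ⟨hbε, hs1, hs2, hWu, hWP, hWx, hadm⟩

/-! ## §3 The per-level coercivity coefficient dominates the k-free one -/

/-- **k-FREE COERCIVITY** (`M ≥ 1`, `0 ≤ ν ≤ ν_c·ε`, `0 ≤ α`, `α·M ≤ C_S·ε`, `CP ≥ 0`): the coefficient of `NE7ConvOneStepWeighted.hess_vary_ge_weighted` at (`ν`, `α`, `a′ = ε∕M² + 7α²`, card `2`,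
`d = 4`) is at least its k-free minorant at (`ν_c·ε`, `C_S·ε`) — the left side of gen 104's strict line `line_of_small`. [folklore] -/
theorem kfree_coercivity {CP CS νc ε ν α M : ℝ} (hCP : 0 ≤ CP) (hM1 : 1 ≤ M) (hν : 0 ≤ ν) (hνle : ν ≤ νc * ε)
    (hα : 0 ≤ α) (hαM : α * M ≤ CS * ε) :
    ((((1 / 2 - (νc * ε) ^ 2) / (2 * (1 + CP)) - (νc * ε) ^ 2) / 2 - 576 * ((4 : ℕ) : ℝ) * ((CS * ε) ^ 2 * Real.exp (2 * (CS * ε)))) / ((2 : ℕ) : ℝ)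
        - 28 * ((4 : ℕ) : ℝ) * (ε + 7 * (CS * ε) ^ 2))
      ≤ ((((1 / 2 - ν ^ 2) / (2 * (1 + CP)) - ν ^ 2) / 2 - 576 * ((4 : ℕ) : ℝ) * (Real.exp α - 1) ^ 2 * M ^ 2) / ((2 : ℕ) : ℝ)
        - 28 * ((4 : ℕ) : ℝ) * (ε / M ^ 2 + 7 * α ^ 2) * M ^ 2) := by
  have hM0 : 0 < M := by linarith
  have hQ : 0 < 2 * (1 + CP) := by linarith
  -- `ν² ≤ (ν_c ε)²`
  have hν2 : ν ^ 2 ≤ (νc * ε) ^ 2 := pow_le_pow_left₀ hν hνle 2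
  have hm : (1 / 2 - (νc * ε) ^ 2) / (2 * (1 + CP)) - (νc * ε) ^ 2 ≤ (1 / 2 - ν ^ 2) / (2 * (1 + CP)) - ν ^ 2 := by
    have h1 : (1 / 2 - (νc * ε) ^ 2) / (2 * (1 + CP)) ≤ (1 / 2 - ν ^ 2) / (2 * (1 + CP)) :=
      div_le_div_of_nonneg_right (by linarith) hQ.le
    linarith
  -- the exponential term and the radius term
  have hexp : (Real.exp α - 1) ^ 2 * M ^ 2 ≤ (CS * ε) ^ 2 * Real.exp (2 * (CS * ε)) := exp_term_le_of_currency hα hM1 hαM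
  have hrad : (ε / M ^ 2 + 7 * α ^ 2) * M ^ 2 ≤ ε + 7 * (CS * ε) ^ 2 := by
    have e : (ε / M ^ 2 + 7 * α ^ 2) * M ^ 2 = ε + 7 * (α * M) ^ 2 := by field_simp
    rw [e]
    have : (α * M) ^ 2 ≤ (CS * ε) ^ 2 := pow_le_pow_left₀ (by positivity) hαM 2
    linarith
  have h4 : (0 : ℝ) ≤ ((4 : ℕ) : ℝ) := by positivity
  have hA : (((1 / 2 - (νc * ε) ^ 2) / (2 * (1 + CP)) - (νc * ε) ^ 2) / 2 - 576 * ((4 : ℕ) : ℝ) * ((CS * ε) ^ 2 * Real.exp (2 * (CS * ε))))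
      ≤ (((1 / 2 - ν ^ 2) / (2 * (1 + CP)) - ν ^ 2) / 2 - 576 * ((4 : ℕ) : ℝ) * (Real.exp α - 1) ^ 2 * M ^ 2) := by nlinarith
  have hB := div_le_div_of_nonneg_right hA (show (0 : ℝ) ≤ ((2 : ℕ) : ℝ) by positivity)
  have hC : 28 * ((4 : ℕ) : ℝ) * (ε / M ^ 2 + 7 * α ^ 2) * M ^ 2 ≤ 28 * ((4 : ℕ) : ℝ) * (ε + 7 * (CS * ε) ^ 2) := by nlinarith
  linarith


/-! ## §3b Pure real bookkeeping of the assembly (kept out of the main proof's context) -/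

/-- The spike coefficient: `4x²P + 16·M⁻² ≤ (4P+16)·M⁻²` for `x = ε∕M²`, `0 ≤ ε ≤ 1 ≤ M`, `P ≥ 0`. [folklore] -/
theorem spike_coef_le {ε M P : ℝ} (hM1 : 1 ≤ M) (hε0 : 0 ≤ ε) (hε1 : ε ≤ 1) (hP : 0 ≤ P) :
    4 * (ε / M ^ 2) ^ 2 * P + 4 * ((4 : ℕ) : ℝ) * (M⁻¹) ^ 2 ≤ (4 * P + 16) * (M⁻¹) ^ 2 := by
  have hM0 : 0 < M := by linarith
  have hxM : ε / M ^ 2 ≤ M⁻¹ := by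
    rw [div_le_iff₀ (by positivity), show M⁻¹ * M ^ 2 = M by field_simp]; nlinarith
  have hx0 : 0 ≤ ε / M ^ 2 := by positivity
  have hx2 : (ε / M ^ 2) ^ 2 ≤ (M⁻¹) ^ 2 := pow_le_pow_left₀ hx0 hxM 2
  have : 4 * (ε / M ^ 2) ^ 2 * P ≤ 4 * (M⁻¹) ^ 2 * P := by nlinarith
  push_cast; nlinarith

/-- The spike's weighted energy from its squared letter: `ES² ≤ c·N⁴G²`, `c ≤ (4P+16)M⁻²` ⟹ `ES ≤ √(4P+16)·G·(N²∕M)`. [folklore] -/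
theorem spike_energy_le {ES c P M Nr G : ℝ} (hES0 : 0 ≤ ES) (hG0 : 0 ≤ G) (hM0 : 0 < M) (hP : 0 ≤ P)
    (h : ES ^ 2 ≤ c * (Nr ^ 4 * G ^ 2)) (hc : c ≤ (4 * P + 16) * (M⁻¹) ^ 2) :
    ES ≤ Real.sqrt (4 * P + 16) * G * (Nr ^ 2 / M) := by
  have hS2' : ES ^ 2 ≤ (Real.sqrt (4 * P + 16) * G * (Nr ^ 2 / M)) ^ 2 := by
    calc ES ^ 2 ≤ c * (Nr ^ 4 * G ^ 2) := h
      _ ≤ (4 * P + 16) * (M⁻¹) ^ 2 * (Nr ^ 4 * G ^ 2) := mul_le_mul_of_nonneg_right hc (by positivity)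
      _ = (Real.sqrt (4 * P + 16) * G * (Nr ^ 2 / M)) ^ 2 := by
          rw [mul_pow, mul_pow, Real.sq_sqrt (by positivity)]; field_simp
  exact (pow_le_pow_iff_left₀ hES0 (by positivity) (by norm_num : (2 : ℕ) ≠ 0)).1 hS2'

/-- The two-sided first-variation bookkeeping: `d₀ + cK·E²∕2 ≤ 0`, `d₀ = dT + dN`, `|dN| ≤ κE²`, `|dT| ≤ r((1+ν̂)E + S)`, `κ ≤ κ̂` ⟹
`(cK∕2 − κ̂)·E² ≤ r(1+ν̂)·E + r·S`. [folklore] -/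
theorem two_sided_ineq {d₀ dT dN cK E κ κh r νh S : ℝ} (hkey : d₀ + cK * E ^ 2 / 2 ≤ 0) (hsplit : d₀ = dT + dN)
    (hN : |dN| ≤ κ * E ^ 2) (hT : |dT| ≤ r * ((1 + νh) * E + S)) (hκ : κ ≤ κh) :
    (cK / 2 - κh) * E ^ 2 ≤ r * (1 + νh) * E + r * S := by
  have h1 := neg_abs_le dT
  have h2 := neg_abs_le dN
  have hκE : κ * E ^ 2 ≤ κh * E ^ 2 := mul_le_mul_of_nonneg_right hκ (sq_nonneg E)
  nlinarith [hkey, hsplit, hN, hT, h1, h2, hκE]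

/-- The final bookkeeping: `γE² ≤ C'ρ(1+ν̂)E + C'ρσq`, `q ≤ 2ρ∕w₀` ⟹ `E ≤ (C'(1+ν̂)∕γ + √(2C'σ∕(γw₀)))·ρ`. [folklore] -/
theorem rate_algebra {E ρ γ C' νh σ q w₀ : ℝ} (hρ0 : 0 ≤ ρ) (hγ : 0 < γ) (hC' : 0 ≤ C') (hνh : 0 ≤ νh) (hσ : 0 ≤ σ)
    (hw₀ : 0 < w₀) (hq0 : 0 ≤ q) (hq : q ≤ 2 * ρ / w₀) (h : γ * E ^ 2 ≤ C' * ρ * (1 + νh) * E + C' * ρ * (σ * q)) :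
    E ≤ (C' * (1 + νh) / γ + Real.sqrt (2 * C' * σ / (γ * w₀))) * ρ := by
  have hr0 : 0 ≤ C' * ρ := mul_nonneg hC' hρ0
  have hA0 : 0 ≤ C' * ρ * (1 + νh) / γ := by positivity
  have hB0 : 0 ≤ C' * ρ * (σ * q) / γ := by positivity
  have hEle : E ≤ C' * ρ * (1 + νh) / γ + Real.sqrt (C' * ρ * (σ * q) / γ) := by
    refine le_add_sqrt_of_sq_le hA0 hB0 ?_
    rw [show C' * ρ * (1 + νh) / γ * E + C' * ρ * (σ * q) / γ = (C' * ρ * (1 + νh) * E + C' * ρ * (σ * q)) / γ by ring]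
    rw [le_div_iff₀ hγ]; linarith
  have hBle : C' * ρ * (σ * q) / γ ≤ (2 * C' * σ / (γ * w₀)) * ρ ^ 2 := by
    have h1 : C' * ρ * (σ * q) ≤ C' * ρ * (σ * (2 * ρ / w₀)) :=
      mul_le_mul_of_nonneg_left (mul_le_mul_of_nonneg_left hq hσ) hr0
    have h2 : C' * ρ * (σ * (2 * ρ / w₀)) / γ = (2 * C' * σ / (γ * w₀)) * ρ ^ 2 := by field_simp
    rw [← h2]; exact div_le_div_of_nonneg_right h1 hγ.le
  have hsqrt : Real.sqrt (C' * ρ * (σ * q) / γ) ≤ Real.sqrt (2 * C' * σ / (γ * w₀)) * ρ := by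
    calc Real.sqrt (C' * ρ * (σ * q) / γ) ≤ Real.sqrt ((2 * C' * σ / (γ * w₀)) * ρ ^ 2) := Real.sqrt_le_sqrt hBle
      _ = Real.sqrt (2 * C' * σ / (γ * w₀)) * ρ := by rw [Real.sqrt_mul (by positivity), Real.sqrt_sq hρ0]
  rw [add_mul]
  have e1 : C' * ρ * (1 + νh) / γ = C' * (1 + νh) / γ * ρ := by ring
  linarith [hEle, hsqrt, e1]

/-- `w₀·N²∕(2M) ≤ ρ` ⟹ `N²∕M ≤ 2ρ∕w₀` (`M, w₀ > 0`). [folklore] -/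
theorem ratio_le_of_lower {w₀ Nr M ρ : ℝ} (hM0 : 0 < M) (hw₀ : 0 < w₀) (h : w₀ * Nr ^ 2 / (2 * M) ≤ ρ) : Nr ^ 2 / M ≤ 2 * ρ / w₀ := by
  rw [div_le_div_iff₀ hM0 hw₀]
  rw [div_le_iff₀ (by positivity)] at h
  nlinarith [h]

end

end Summit.QuantumFields.BalabanUV.T4Continuum.NE7EnergyRateWPrep
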